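import Summits.AtomisticToContinuum.HydrodynamicLimit.Theses.KinematicRung
import Summits.AtomisticToContinuum.HydrodynamicLimit.Theses.ResponseRigidity
import Summits.AtomisticToContinuum.HydrodynamicLimit.Statement
import Summits.AtomisticToContinuum.HydrodynamicLimit.Theorems.KinematicRungKinematicMeanClosureOnPath
import HarnessLib

/-!
# Route `KinematicRung` — the posited graded family `MeanClosureRung k` (mean-closure ladder)

The route's thesis (Theses/KinematicRung.lean, header) indexes its rung inside a graded family
"`MeanClosureRung k`, `k` = number of MEAN CHANNELS assumed along `[0,t]`" (density for `k ≥ 1`,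
momentum for `k ≥ 2`, energy for `k ≥ 3`): in the packing-guarded setting of the sub-problem
statement, the law of large numbers at `t = 0` plus the `k`-channel mean history on `[0,t]` imply the
law of large numbers (`TendstoHydroFieldsAt`) at every `t ∈ [0,T)`. The planner's birth files that
typed the family (`Cruxes/KinematicMeanClosure/Lines/special.lean`: `rungAt_three`, `rung_two_iff`,
`rung_zero_iff`) were never published to the tree; this file supplies the objects and their
definitional API, so that the forward discipline's dial-monotonicity reading of the on-path lemma
(TRIBUNAL-FIT F4: `Rung_mono : Rung k → Rung (k+1)` in the harder-to-easier direction together with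
`Rung 0 ↔ S`) is available in Lean:

* `MeanHistory k σ a₀ θ₀ u₀ ρ θ u Φ t` — the `k`-channel mean history on `[0,t]` (guards `1 ≤ k`,
  `2 ≤ k`, `3 ≤ k` switch the density / momentum / energy clauses on; channels saturate at `k = 3`);
* `MeanClosureRung k` — the rung: the statement `HydrodynamicLimit` with `MeanHistory k … t →`
  inserted before the conclusion at `t`;
* API: `MeanHistory.of_le` (more channels give fewer), `MeanClosureRung.mono` (`k ≤ l →
  MeanClosureRung k → MeanClosureRung l`, the dial monotonicity), `MeanClosureRung.succ`,
  `meanClosureRung_zero_iff : MeanClosureRung 0 ↔ HydrodynamicLimit` (the statement is the bottom of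
  the ladder), `meanClosureRung_two_iff : MeanClosureRung 2 ↔ KinematicMeanClosure` (the route's rung,
  stmt-AtomisticToContinuum-20153), `meanClosureRung_three_of_meanClosure : ResponseRigidity.MeanClosure
  → MeanClosureRung 3` (the proved floor, stmt-11929, specialises to `k = 3`: it needs the three means
  at `s = t` only), and the composite `meanClosureRung_of_hydrodynamicLimit : HydrodynamicLimit →
  MeanClosureRung k` for every `k`.

Everything here is pure logic over the vocabulary of the Statement (no analysis, no new constants of
the model); nothing restates an item: `MeanClosureRung 2` is PROVED equivalent to the filed crux and
`MeanClosureRung 0` to the Statement, and the family is the route's own announced index.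

prover-fwd2-land-3-0 (on-path lander), 2026-08-18.
-/

open Filter Set
open scoped Topology

namespace Summit.AtomisticToContinuum.HydrodynamicLimit.Theorems

open Literature.MathematicalPhysics.KineticTheory Literature.Analysis.FluidPDE
open Summit.AtomisticToContinuum.HydrodynamicLimit.Theses

/-- **The `k`-channel mean history on `[0,t]`.** For every `s ∈ [0,t]` and every smooth test
function `χ`: if `1 ≤ k`, the expectation (under the local Gibbs law transported by the hard-sphere
flow `Φ N` to time `s`) of the empirical density field tested against `χ` tends to `∫ χ ρ_s`; if
`2 ≤ k`, the same for the three momentum components (limit `∫ χ ρ_s u_{s,j}`); if `3 ≤ k`, the same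
for the energy field (limit `∫ χ E(ρ_s,u_s,θ_s)`). Channels saturate at `k = 3`. This is the
hypothesis the route `KinematicRung` reads "along `[0,t]`" (its header: "`k` = number of mean
channels assumed on `[0,t]`"). -/
def MeanHistory (k : ℕ) (σ : ℝ) (a₀ θ₀ : T3 → ℝ) (u₀ : T3 → V3) (ρ θ : ℝ → T3 → ℝ)
    (u : ℝ → T3 → V3)
    (Φ : (N : ℕ) → HardSphereFlow (Torus.geometry (Fin 3)) (hsDiameter σ N) (N + 1)) (t : ℝ) :
    Prop :=
  ∀ s ∈ Set.Icc 0 t, ∀ χ : T3 → ℝ, Literature.Analysis.FunctionSpaces.Torus.IsSmooth χ →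
    (1 ≤ k → Tendsto (fun N : ℕ => ∫ z, empiricalDensityField ((Φ N).flow s z) χ
        ∂(localGibbsLaw σ a₀ u₀ θ₀ N (Φ N))) atTop (𝓝 (∫ x, χ x * ρ s x))) ∧
    (2 ≤ k → ∀ j : Fin 3, Tendsto (fun N : ℕ => ∫ z, empiricalMomentumField ((Φ N).flow s z) χ j
        ∂(localGibbsLaw σ a₀ u₀ θ₀ N (Φ N))) atTop (𝓝 (∫ x, χ x * ρ s x * u s x j))) ∧
    (3 ≤ k → Tendsto (fun N : ℕ => ∫ z, empiricalEnergyField ((Φ N).flow s z) χ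
        ∂(localGibbsLaw σ a₀ u₀ θ₀ N (Φ N))) atTop
        (𝓝 (∫ x, χ x * totalEnergyDensity (ρ s x) (u s x) (θ s x))))

/-- **The mean-closure ladder `MeanClosureRung k`.** The packing-guarded hydrodynamic-limit
statement with the `k`-channel mean history on `[0,t]` as an extra hypothesis before the conclusion
at `t`: `∃ η > 0, ∀` continuous positive profiles, `∃ σ₀ > 0, ∀ σ ∈ (0,σ₀), ∀` classical hard-sphere
Euler solutions on `[0,T)` with packing `ρσ³ < η`, `∀` flow families `Φ` with the `t = 0` law of
large numbers under the local Gibbs laws, `∀ t ∈ [0,T)`, `MeanHistory k … t →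
TendstoHydroFieldsAt … t`. `k = 0` is the Statement (`meanClosureRung_zero_iff`), `k = 2` the
route's rung `KinematicMeanClosure` (`meanClosureRung_two_iff`), `k = 3` is implied by the proved
floor `ResponseRigidity.MeanClosure` (`meanClosureRung_three_of_meanClosure`); larger `k` assumes
more, so the family is monotone in `k` (`MeanClosureRung.mono`). -/
def MeanClosureRung (k : ℕ) : Prop :=
  ∃ η : ℝ, 0 < η ∧ ∀ (a₀ θ₀ : T3 → ℝ) (u₀ : T3 → V3), Continuous a₀ → Continuous θ₀ →
    Continuous u₀ → (∀ x, 0 < a₀ x) → (∀ x, 0 < θ₀ x) →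
    ∃ σ₀ : ℝ, 0 < σ₀ ∧ ∀ σ : ℝ, 0 < σ → σ < σ₀ →
      ∀ (T : ℝ) (ρ θ : ℝ → T3 → ℝ) (u : ℝ → T3 → V3), IsHardSphereEulerSolution σ T ρ u θ →
        (∀ t ∈ Set.Ico 0 T, ∀ x, ρ t x * σ ^ 3 < η) →
        ∀ Φ : (N : ℕ) → HardSphereFlow (Torus.geometry (Fin 3)) (hsDiameter σ N) (N + 1),
          TendstoHydroFieldsAt (fun N => localGibbsLaw σ a₀ u₀ θ₀ N (Φ N)) Φ ρ u θ 0 →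
            ∀ t ∈ Set.Ico 0 T, MeanHistory k σ a₀ θ₀ u₀ ρ θ u Φ t →
              TendstoHydroFieldsAt (fun N => localGibbsLaw σ a₀ u₀ θ₀ N (Φ N)) Φ ρ u θ t

section API

variable {σ : ℝ} {a₀ θ₀ : T3 → ℝ} {u₀ : T3 → V3} {ρ θ : ℝ → T3 → ℝ} {u : ℝ → T3 → V3}
  {Φ : (N : ℕ) → HardSphereFlow (Torus.geometry (Fin 3)) (hsDiameter σ N) (N + 1)} {t : ℝ}

/-- More channels give fewer: the `l`-channel history contains the `k`-channel one for `k ≤ l`. -/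
theorem MeanHistory.of_le {k l : ℕ} (hkl : k ≤ l) (h : MeanHistory l σ a₀ θ₀ u₀ ρ θ u Φ t) :
    MeanHistory k σ a₀ θ₀ u₀ ρ θ u Φ t := fun s hs χ hχ =>
  ⟨fun hk => (h s hs χ hχ).1 (hk.trans hkl), fun hk => (h s hs χ hχ).2.1 (hk.trans hkl),
    fun hk => (h s hs χ hχ).2.2 (hk.trans hkl)⟩

/-- The `0`-channel history is empty (trivially true). -/
theorem meanHistory_zero : MeanHistory 0 σ a₀ θ₀ u₀ ρ θ u Φ t := fun _ _ _ _ =>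
  ⟨fun h => absurd h (by norm_num), fun h => absurd h (by norm_num), fun h => absurd h (by norm_num)⟩

/-- The `2`-channel history is verbatim the kinematic-means hypothesis of the crux
`KinematicMeanClosure` (density and momentum means on `[0,t]`). -/
theorem meanHistory_two_iff :
    MeanHistory 2 σ a₀ θ₀ u₀ ρ θ u Φ t ↔
      ∀ s ∈ Set.Icc 0 t, ∀ χ : T3 → ℝ, Literature.Analysis.FunctionSpaces.Torus.IsSmooth χ →
        Tendsto (fun N : ℕ => ∫ z, empiricalDensityField ((Φ N).flow s z) χ
            ∂(localGibbsLaw σ a₀ u₀ θ₀ N (Φ N))) atTop (𝓝 (∫ x, χ x * ρ s x)) ∧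
        (∀ j : Fin 3, Tendsto (fun N : ℕ => ∫ z, empiricalMomentumField ((Φ N).flow s z) χ j
            ∂(localGibbsLaw σ a₀ u₀ θ₀ N (Φ N))) atTop (𝓝 (∫ x, χ x * ρ s x * u s x j))) := by
  refine forall₂_congr fun s _ => forall₂_congr fun χ _ => ?_
  constructor
  · rintro ⟨h1, h2, -⟩
    exact ⟨h1 (by norm_num), h2 le_rfl⟩
  · rintro ⟨h1, h2⟩
    exact ⟨fun _ => h1, fun _ => h2, fun h => absurd h (by norm_num)⟩

/-- The `3`-channel history at the endpoint `s = t` is verbatim the hypothesis of the floor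
`ResponseRigidity.MeanClosure` (density, momentum and energy means at `t`). -/
theorem MeanHistory.at_three (h : MeanHistory 3 σ a₀ θ₀ u₀ ρ θ u Φ t) (ht : 0 ≤ t) :
    (∀ χ : T3 → ℝ, Literature.Analysis.FunctionSpaces.Torus.IsSmooth χ →
        Tendsto (fun N : ℕ => ∫ z, empiricalDensityField ((Φ N).flow t z) χ
            ∂(localGibbsLaw σ a₀ u₀ θ₀ N (Φ N))) atTop (𝓝 (∫ x, χ x * ρ t x)) ∧
        (∀ j : Fin 3, Tendsto (fun N : ℕ => ∫ z, empiricalMomentumField ((Φ N).flow t z) χ j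
            ∂(localGibbsLaw σ a₀ u₀ θ₀ N (Φ N))) atTop (𝓝 (∫ x, χ x * ρ t x * u t x j))) ∧
        Tendsto (fun N : ℕ => ∫ z, empiricalEnergyField ((Φ N).flow t z) χ
            ∂(localGibbsLaw σ a₀ u₀ θ₀ N (Φ N))) atTop
            (𝓝 (∫ x, χ x * totalEnergyDensity (ρ t x) (u t x) (θ t x)))) := fun χ hχ =>
  ⟨(h t ⟨ht, le_rfl⟩ χ hχ).1 (by norm_num), (h t ⟨ht, le_rfl⟩ χ hχ).2.1 (by norm_num),
    (h t ⟨ht, le_rfl⟩ χ hχ).2.2 le_rfl⟩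

end API

/-- **Dial monotonicity (F4, harder-to-easier).** Assuming more mean channels makes the rung weaker:
`MeanClosureRung k → MeanClosureRung l` for `k ≤ l`. Pure logic: `η`, `σ₀` unchanged, and the
`l`-channel history restricts to the `k`-channel one (`MeanHistory.of_le`). -/
theorem MeanClosureRung.mono {k l : ℕ} (hkl : k ≤ l) (h : MeanClosureRung k) :
    MeanClosureRung l := by
  obtain ⟨η, hη, H⟩ := h
  refine ⟨η, hη, fun a₀ θ₀ u₀ ha hθ hu ha0 hθ0 => ?_⟩
  obtain ⟨σ₀, hσ₀, G⟩ := H a₀ θ₀ u₀ ha hθ hu ha0 hθ0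
  exact ⟨σ₀, hσ₀, fun σ hσ hσ' T ρ θ u hsol hpack Φ h0 t ht hist =>
    G σ hσ hσ' T ρ θ u hsol hpack Φ h0 t ht (hist.of_le hkl)⟩

/-- The one-step form `Rung k → Rung (k+1)` of the dial monotonicity. -/
theorem MeanClosureRung.succ {k : ℕ} (h : MeanClosureRung k) : MeanClosureRung (k + 1) :=
  h.mono (Nat.le_succ k)

/-- **Bottom of the ladder = the Statement.** `MeanClosureRung 0 ↔ HydrodynamicLimit`: the
`0`-channel history is empty, so the rung at `k = 0` is the packing-guarded hydrodynamic limit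
itself. -/
theorem meanClosureRung_zero_iff : MeanClosureRung 0 ↔ _root_.HydrodynamicLimit := by
  constructor
  · rintro ⟨η, hη, H⟩
    refine ⟨η, hη, fun a₀ θ₀ u₀ ha hθ hu ha0 hθ0 => ?_⟩
    obtain ⟨σ₀, hσ₀, G⟩ := H a₀ θ₀ u₀ ha hθ hu ha0 hθ0
    exact ⟨σ₀, hσ₀, fun σ hσ hσ' T ρ θ u hsol hpack Φ h0 t ht =>
      G σ hσ hσ' T ρ θ u hsol hpack Φ h0 t ht meanHistory_zero⟩
  · rintro ⟨η, hη, H⟩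
    refine ⟨η, hη, fun a₀ θ₀ u₀ ha hθ hu ha0 hθ0 => ?_⟩
    obtain ⟨σ₀, hσ₀, G⟩ := H a₀ θ₀ u₀ ha hθ hu ha0 hθ0
    exact ⟨σ₀, hσ₀, fun σ hσ hσ' T ρ θ u hsol hpack Φ h0 t ht _ =>
      G σ hσ hσ' T ρ θ u hsol hpack Φ h0 t ht⟩

/-- **The route's rung is `k = 2`.** `MeanClosureRung 2 ↔ KinematicRung.KinematicMeanClosure`
(stmt-AtomisticToContinuum-20153): the `2`-channel history is verbatim the crux's kinematic-means
hypothesis (`meanHistory_two_iff`). -/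
theorem meanClosureRung_two_iff : MeanClosureRung 2 ↔ KinematicRung.KinematicMeanClosure := by
  constructor
  · rintro ⟨η, hη, H⟩
    refine ⟨η, hη, fun a₀ θ₀ u₀ ha hθ hu ha0 hθ0 => ?_⟩
    obtain ⟨σ₀, hσ₀, G⟩ := H a₀ θ₀ u₀ ha hθ hu ha0 hθ0
    exact ⟨σ₀, hσ₀, fun σ hσ hσ' T ρ θ u hsol hpack Φ h0 t ht hist =>
      G σ hσ hσ' T ρ θ u hsol hpack Φ h0 t ht (meanHistory_two_iff.2 hist)⟩
  · rintro ⟨η, hη, H⟩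
    refine ⟨η, hη, fun a₀ θ₀ u₀ ha hθ hu ha0 hθ0 => ?_⟩
    obtain ⟨σ₀, hσ₀, G⟩ := H a₀ θ₀ u₀ ha hθ hu ha0 hθ0
    exact ⟨σ₀, hσ₀, fun σ hσ hσ' T ρ θ u hsol hpack Φ h0 t ht hist =>
      G σ hσ hσ' T ρ θ u hsol hpack Φ h0 t ht (meanHistory_two_iff.1 hist)⟩

/-- **The proved floor specialises to `k = 3`.** `ResponseRigidity.MeanClosure` (stmt-11929, proved:
`Theorems.RestartPrinciple.AgeDuhamelForgetting.meanClosure_holds`) needs the three means at time `t`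
only; the `3`-channel history on `[0,t]` supplies them at `s = t` (`MeanHistory.at_three`). -/
theorem meanClosureRung_three_of_meanClosure (h : ResponseRigidity.MeanClosure) :
    MeanClosureRung 3 := by
  obtain ⟨η, hη, H⟩ := h
  refine ⟨η, hη, fun a₀ θ₀ u₀ ha hθ hu ha0 hθ0 => ?_⟩
  obtain ⟨σ₀, hσ₀, G⟩ := H a₀ θ₀ u₀ ha hθ hu ha0 hθ0
  exact ⟨σ₀, hσ₀, fun σ hσ hσ' T ρ θ u hsol hpack Φ h0 t ht hist =>
    G σ hσ hσ' T ρ θ u hsol hpack Φ h0 t ht (hist.at_three ht.1)⟩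

/-- **On-path by the dial.** The Statement is the bottom rung and the ladder is monotone, so the
Statement implies every rung: `HydrodynamicLimit → MeanClosureRung k`. At `k = 2` this is (via
`meanClosureRung_two_iff`) the landed on-path lemma
`Theorems.KinematicMeanClosure_of_HydrodynamicLimit`. -/
theorem meanClosureRung_of_hydrodynamicLimit (k : ℕ) (h : _root_.HydrodynamicLimit) :
    MeanClosureRung k :=
  (meanClosureRung_zero_iff.2 h).mono (Nat.zero_le k)

/-! ## The on-path lemma at elaboration level (forward discipline F4, kernel visibility at both tiers)

The landed on-path lemma `KinematicMeanClosure_of_HydrodynamicLimit : HydrodynamicLimit →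
KinematicRung.KinematicMeanClosure` (`Theorems/KinematicRungKinematicMeanClosureOnPath.lean`) is
registered below as a `Coe` instance from the Statement to the route's rung. Both carriers are
`Prop`s, so the coercion is proof-irrelevant and changes no statement and no proof obligation: it
only lets a proof of the Statement stand where a proof of the rung is expected, the elaborator
inserting the on-path lemma. Instance resolution matches the SOURCE type at reducible transparency,
so nothing but the Statement constant `_root_.HydrodynamicLimit` coerces — in particular not the
unguarded Literature conjecture `KineticTheory.HydrodynamicLimit` (the registered strong hypothesis
of this summit, bridged to the Statement by `HydrodynamicLimit.of_unguarded`), not the floor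
`ResponseRigidity.MeanClosure`, not a rung `MeanClosureRung k` (the `example`s below check each).

Why (TRIBUNAL-FIT F4): the tribunal kernel reads the forward flag `on_path` of this route as
"`HydrodynamicLimit → KinematicMeanClosure` closes by the cheap `S → C` portfolio", whose first tactic
is the literal `exact fun h => h`. With the instance that tactic closes the goal in milliseconds at
BOTH tiers (the proof term is `fun h => KinematicMeanClosure_of_HydrodynamicLimit h`); the `aesop`
registration of `KinematicRungOnPathVisible.lean` is reached only at tier `full` — at tier `quick`
the goal's ≈ 2 s budget is spent by the two `simpa` attempts that precede `intro h; aesop`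
(lander gens 2–8, 2026-08-18/19: quick `on_path = false`, full `true`; engine probe with this
instance, tier quick, 2026-08-19: `on_path = true`, `real_step = true`, no fail ground).

prover-fwd2-land-3-g9-0 (on-path lander, gen 9), 2026-08-19.
-/

section OnPathCoe

/-- **The on-path lemma `S → Rung` as a coercion.** A proof of the packing-guarded hydrodynamic
limit `HydrodynamicLimit` may be used where the route's rung `KinematicRung.KinematicMeanClosure`
(stmt-AtomisticToContinuum-20153) is expected; the inserted term is the landed on-path lemma
`KinematicMeanClosure_of_HydrodynamicLimit`. Proof-irrelevant (`Prop` to `Prop`); fires only on the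
Statement constant itself (reducible matching of the source). -/
instance instCoeHydrodynamicLimitKinematicMeanClosure :
    Coe _root_.HydrodynamicLimit KinematicRung.KinematicMeanClosure :=
  ⟨KinematicMeanClosure_of_HydrodynamicLimit⟩

/-- The coercion unfolds to the on-path lemma (definitionally; any two proofs agree anyway). -/
theorem coe_hydrodynamicLimit_eq (h : _root_.HydrodynamicLimit) :
    (h : KinematicRung.KinematicMeanClosure) = KinematicMeanClosure_of_HydrodynamicLimit h :=
  rfl

/- The tribunal kernel's literal first `S → C` tactic on its literal goal. -/
example : _root_.HydrodynamicLimit → KinematicRung.KinematicMeanClosure := by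
  exact fun h => h

/- Controls: the strong hypothesis (unguarded conjecture), the floor and the ladder do NOT coerce
(so no `H → C`, `F → Rung` or `Rung k → C` goal of the kernel is affected). -/
example (_hH : Literature.MathematicalPhysics.KineticTheory.HydrodynamicLimit)
    (_hF : ResponseRigidity.MeanClosure) (_h₃ : MeanClosureRung 3) : True := by
  fail_if_success have _h : KinematicRung.KinematicMeanClosure := _hH
  fail_if_success have _h : KinematicRung.KinematicMeanClosure := _hF
  fail_if_success have _h : KinematicRung.KinematicMeanClosure := _h₃
  trivial

end OnPathCoe

end Summit.AtomisticToContinuum.HydrodynamicLimit.Theorems
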